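import Summits.ValiantsHypothesis.ValiantsHypothesis.Theorems.PolyaContinuedSignedCoverLittleParity
import Summits.ValiantsHypothesis.ValiantsHypothesis.Theorems.PolyaContinuedSignedCoverLittleStubEven
import Literature.Combinatorics.SimpleGraph.MatchingMinor
import Literature.Combinatorics.SimpleGraph.LittleTheorem
import HarnessLib

/-!
# Crux `SignedCoverLittle` (stmt-ValiantsHypothesis-7426) — line `even_induction` (skeleton, v5)

Lead skeleton (seat val-width-7426-p1, 2026-08-28). The item is `SignedCoverLittle` ⇔ label transfer
(`signedCoverLittle_iff_labelTransfer`). v5: the H-side is LANDED by the 7426 port —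
`even_multiplicity_of_labelIdentity_kstd` / `not_isPfaffianBipartite_of_labelIdentity_kstd` /
`signedCoverLittle_of_chain` (`Theorems/PolyaContinuedSignedCoverLittleStubEven.lean`, seats p2/p3/p4,
after `…Transfer`, `…TransferCircuits`, `…NormalForm`, `…Kstd`, `…Pipeline`, `…EarC/EarD`, `…Count`,
`…CaseB`, `…Even`, `…EvenCells`; the lead's `…Parity.lean` is the generic parity endgame). The ONLY
remaining stub is the E-side chain:

* `stub_chain` (mechanical, M–L): a non-Pfaffian target reduces — by Little's theorem
  (`Little1975_…_holds`), restriction (`labelIdentity_restrict`), transposition, and the SAME-BOARD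
  bicontraction substitution (fold) — to a relabelling of the standard target
  `kstd n = K_{3,3} ⊔ diagonal`, for a SUBGRAPH of the source. Its DRIVER is landed/queued as
  `labelIdentity_chain_of` (`Theorems/PolyaContinuedSignedCoverLittleChain.lean`): strong induction on
  `E.card` from four section specs (fold = p4 `(SB)`, no-parallel = p2 `SC3`, transpose = p2 `SC1`,
  base = p3 `exists_relabel_kstd_of_minimal`).

`SignedCoverLittle_of := signedCoverLittle_of_chain stub_chain` closes the crux.
-/

noncomputable section

set_option linter.dupNamespace false

namespace Summit.ValiantsHypothesis.ValiantsHypothesis.Cruxes.SignedCoverLittle.EvenInduction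

open MvPolynomial Finset Literature.Combinatorics.SimpleGraph Equiv
open Summit.ValiantsHypothesis.PolyaContinued

variable {n : ℕ}

/-! ### Stubs (self-contained statements) -/

/-- STUB (E-side chain). [difficulty: M–L, mechanical; all ingredients in tree] -/
theorem stub_chain : ∀ (n : ℕ) (H E : Finset (Fin n × Fin n)) (φ : Fin n × Fin n → Fin n × Fin n),
    (∑ σ : Perm (Fin n), if (∀ i, (i, σ i) ∈ H) then
        ∏ i, (X (φ (i, σ i)) : MvPolynomial (Fin n × Fin n) ℂ) else 0) = perfectMatchingPoly E ℂ →
    ¬ IsPfaffianBipartite E →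
    ∃ (H₁ : Finset (Fin n × Fin n)) (φ₁ : Fin n × Fin n → Fin n × Fin n) (ρ κ : Perm (Fin n)),
      H₁ ⊆ H ∧
      (∑ σ : Perm (Fin n), if (∀ i, (i, σ i) ∈ H₁) then
          ∏ i, (X (φ₁ (i, σ i)) : MvPolynomial (Fin n × Fin n) ℂ) else 0) =
        perfectMatchingPoly (relabel (Finset.univ.filter fun e : Fin n × Fin n =>
          ((e.1 : ℕ) < 3 ∧ (e.2 : ℕ) < 3) ∨ (e.1 = e.2 ∧ 3 ≤ (e.1 : ℕ))) ρ κ) ℂ := by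
  sorry

/-- **Composition (v5).** The H-side of the line is LANDED by the port (seats p2/p3/p4):
`signedCoverLittle_of_chain` (`…SignedCoverLittleStubEven.lean`: normal form → five dicircuits →
(CS) forks → two-circuit ear lemma → even coverage certificate) gives the item from `stub_chain`
alone. The driver of `stub_chain` is `labelIdentity_chain_of` (`…SignedCoverLittleChain.lean`, from the
four section specs fold / no-parallel / transpose / base). -/
theorem SignedCoverLittle_of :
    Summit.ValiantsHypothesis.ValiantsHypothesis.Theses.PolyaContinued.SignedCoverLittle :=
  signedCoverLittle_of_chain stub_chain

end Summit.ValiantsHypothesis.ValiantsHypothesis.Cruxes.SignedCoverLittle.EvenInduction
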